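import Summits.BirchSwinnertonDyer.Rank1Residual.P2.CongruentNumberSilentEvenFiveThetaCMClassFieldSelmer
import Literature.NumberTheory.EllipticCurves.CongruentNumberEvenFiveSelmerBound
import HarnessLib

/-!
# Cell `bsd-monsky`, route B: C-P2-1 on `𝒮⁻` from ONE Literature display ALONE — the `2`-Selmer input
# discharged by the tree's complete `2`-descent (`#Sel⁽²⁾(E_{2pq}/ℚ) ≤ 8` is a kernel theorem)

HONEST FRAMING (cell `bsd-monsky`, run/shared/lean/pub/bsd-monsky/; README §1): ONE theorem on ONE explicit
infinite family of quadratic twists of the congruent number curve at the prime `2`; not "BSD for rank ≤ 1",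
nothing at odd primes; nothing is booked by this file. The corners of route B so far took the `2`-Selmer input
as a DISPLAYED fact — Aoki 1999 Thm. 2.2 (`hAo`), Monsky's appendix to Heath-Brown 1994 (`hMe`) — or as the
in-house hypothesis `hSel : #Sel₂(E_{2pq}) ≤ 8` on `𝒮⁻` (`…ThetaCMClassFieldSelmer.lean`, the slot). THIS file
fills the slot with the tree theorem
`Literature.NumberTheory.EllipticCurves.card_selmerGroup_two_le_eight_congruentNumberCurve_two_mul_of_jacobiSym_eq_neg_one`
(`CongruentNumberEvenFiveSelmerBound.lean`: complete `2`-descent on SELMER classes — Silverman AEC X.1.4 /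
X.4.9 on the tree's cohomological `Sel⁽²⁾`, through the descent–Selmer bridge of
`TwoDescentKummerBridge{,Local,GoodPlace,Rat,AdditivePlace,RealPlace}.lean`; seven `𝔽₂`-coordinates, four
relations from the places `p`, `q`, `∞` and the good primes; no `2`-adic condition). Hence:

* `selmer_le_eight_sMinus` — `#Sel₂(E_{2pq}) ≤ 8` for every pair of `𝒮⁻`, in the binder shape of the doors;
* **`congruentSilentEvenFiveBSDTwo_of_cmPointClassFieldData_descent (hCF)`** — C-P2-1 = Theorem 1.1 on `𝒮⁻`
  relative to the ONE named Literature display `tyz_cmPointClassFieldData` (TYZ §3 sentences + Cox Thm. 6.1 (ii)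
  / Thm. 9.18, every conjunct printed) and NOTHING ELSE: no Aoki, no Heath-Brown 1994, no Monsky 1990, no
  Rédei–Reichardt, no GZK; the sharper form `…OrdTwo…` and the pair form likewise;
* the same from the unsplit display `tyz_cmPointGaloisData` (`…_of_cmPointGaloisData_descent`) and from the
  route-B display `K_B = thetaGenusPointDatum` for all pairs (`…_of_thetaDisplay_descent`).

One-line compositions of `…GenusParity.lean`'s `…_of_thetaDisplay_of_selmer_le_eight` /
`…ThetaCMClassFieldSelmer.lean`'s `…_of_cmPointClassFieldData_of_selmer_le_eight` with the descent theorem.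
CONDITIONAL on the one display; nothing asserted; the conjecture `Prop`s stay `@[conjecture]`; no mark moved.
[cite: TianYuanZhang2017, §3.1, Prop. 3.2, Thm. 3.5, Thm. 3.6, Lemma 3.21] [cite: Cox2013, Theorem 6.1 (ii) and Theorem 9.18]
[cite: SilvermanAEC2009, Prop. X.1.4, Prop. X.4.9, Thm. X.4.2] [cite: Miller2011LMS, Def. 1.1 (arXiv:1010.2431 p. 3)]
-/

noncomputable section

open scoped Classical

open WeierstrassCurve NumberField Literature.NumberTheory.EllipticCurves
  Literature.NumberTheory.EllipticCurves.TianYuanZhang2017 Literature.NumberTheory.QuadraticFields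

namespace Summit.BirchSwinnertonDyer.Rank1Residual.P2

open ThetaDescent Conjectures

/-! ## §0 The `2`-Selmer bound on `𝒮⁻`, in the binder shape of the doors (a tree theorem) -/

/-- **`#Sel₂(E_{2pq}) ≤ 8` on all of `𝒮⁻`** — the binder `hSel` / `hD` of the cell's doors, PROVED: the tree's
complete `2`-descent on Selmer classes (`CongruentNumberEvenFiveSelmerBound.lean`). Unconditional.
[cite: SilvermanAEC2009, Prop. X.1.4, Prop. X.4.9] -/
theorem selmer_le_eight_sMinus :
    ∀ p q : ℕ, p.Prime → q.Prime → p % 8 = 5 → q % 4 = 3 → jacobiSym p q = -1 →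
      Nat.card ((congruentNumberCurve (2 * (p * q))).selmerGroup 2) ≤ 8 :=
  fun _ _ hp hq hp5 hq4 hj =>
    card_selmerGroup_two_le_eight_congruentNumberCurve_two_mul_of_jacobiSym_eq_neg_one hp hq hp5 hq4 hj

/-! ## §1 Route B's corner from the split Literature display ALONE -/

/-- **C-P2-1, sharper (`Ш_an`-unit) form, on `𝒮⁻` from `tyz_cmPointClassFieldData` ALONE** — the `2`-Selmer
input is the tree's `2`-descent theorem; no Aoki, no HB94, no Monsky 1990, no Rédei–Reichardt, no GZK.
CONDITIONAL on the one display; nothing asserted. [cite: TianYuanZhang2017, §1 ((1.1)), Thm. 3.5, Prop. 3.2, Thm. 3.6]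
[cite: Cox2013, Theorem 6.1 (ii) and Theorem 9.18] [cite: SilvermanAEC2009, Prop. X.1.4, Prop. X.4.9] -/
theorem congruentSilentEvenFiveOrdTwo_of_cmPointClassFieldData_descent (hCF : tyz_cmPointClassFieldData) :
    CongruentSilentEvenFiveOrdTwo :=
  congruentSilentEvenFiveOrdTwo_of_cmPointClassFieldData_of_selmer_le_eight hCF selmer_le_eight_sMinus

/-- **C-P2-1 = Theorem 1.1 on `𝒮⁻` (`ord_{s=1} L(E_{2pq}, s) = 1 ∧ BSD(E_{2pq}, 2)`) from
`tyz_cmPointClassFieldData` ALONE** — ONE named Literature display whose every conjunct is a printed sentence;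
the `2`-Selmer input is the tree's `2`-descent theorem. CONDITIONAL on the one display; nothing asserted.
[cite: TianYuanZhang2017, §1 ((1.1)), Thm. 3.5, Prop. 3.2, Thm. 3.6] [cite: Cox2013, Theorem 6.1 (ii) and Theorem 9.18]
[cite: SilvermanAEC2009, Prop. X.1.4, Prop. X.4.9, Thm. X.4.2] [cite: Miller2011LMS, Def. 1.1 (arXiv:1010.2431 p. 3)] -/
theorem congruentSilentEvenFiveBSDTwo_of_cmPointClassFieldData_descent (hCF : tyz_cmPointClassFieldData) :
    CongruentSilentEvenFiveBSDTwo :=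
  congruentSilentEvenFiveBSDTwo_of_cmPointClassFieldData_of_selmer_le_eight hCF selmer_le_eight_sMinus

/-- **Both typed forms of C-P2-1 on `𝒮⁻` from `tyz_cmPointClassFieldData` ALONE.** CONDITIONAL; nothing asserted.
[cite: TianYuanZhang2017, Thm. 3.5, Prop. 3.2, Thm. 3.6] [cite: Cox2013, Theorem 6.1 (ii) and Theorem 9.18]
[cite: SilvermanAEC2009, Prop. X.1.4, Prop. X.4.9] -/
theorem congruentSilentEvenFive_pair_of_cmPointClassFieldData_descent (hCF : tyz_cmPointClassFieldData) :
    CongruentSilentEvenFiveOrdTwo ∧ CongruentSilentEvenFiveBSDTwo :=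
  ⟨congruentSilentEvenFiveOrdTwo_of_cmPointClassFieldData_descent hCF,
    congruentSilentEvenFiveBSDTwo_of_cmPointClassFieldData_descent hCF⟩

/-! ## §2 The same from the unsplit display `tyz_cmPointGaloisData` and from the route-B display `K_B` -/

/-- **C-P2-1, sharper form, on `𝒮⁻` from `tyz_cmPointGaloisData` ALONE.** CONDITIONAL; nothing asserted.
[cite: TianYuanZhang2017, Thm. 3.5, Prop. 3.2, Thm. 3.6, Lemma 3.21] [cite: SilvermanAEC2009, Prop. X.1.4, Prop. X.4.9] -/
theorem congruentSilentEvenFiveOrdTwo_of_cmPointGaloisData_descent (hCM : tyz_cmPointGaloisData) :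
    CongruentSilentEvenFiveOrdTwo :=
  congruentSilentEvenFiveOrdTwo_of_thetaDisplay_of_selmer_le_eight (thetaDisplay_of_cmPointGaloisData hCM)
    selmer_le_eight_sMinus

/-- **C-P2-1 = Theorem 1.1 on `𝒮⁻` from `tyz_cmPointGaloisData` ALONE.** CONDITIONAL; nothing asserted.
[cite: TianYuanZhang2017, Thm. 3.5, Prop. 3.2, Thm. 3.6, Lemma 3.21] [cite: SilvermanAEC2009, Prop. X.1.4, Prop. X.4.9, Thm. X.4.2]
[cite: Miller2011LMS, Def. 1.1 (arXiv:1010.2431 p. 3)] -/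
theorem congruentSilentEvenFiveBSDTwo_of_cmPointGaloisData_descent (hCM : tyz_cmPointGaloisData) :
    CongruentSilentEvenFiveBSDTwo :=
  congruentSilentEvenFiveBSDTwo_of_thetaDisplay_of_selmer_le_eight (thetaDisplay_of_cmPointGaloisData hCM)
    selmer_le_eight_sMinus

/-- **C-P2-1, sharper form, on `𝒮⁻` from the route-B display `K_B = thetaGenusPointDatum` (all pairs) ALONE.**
CONDITIONAL; nothing asserted. [cite: TianYuanZhang2017, Thm. 3.5 and §3] [cite: SilvermanAEC2009, Prop. X.1.4, Prop. X.4.9] -/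
theorem congruentSilentEvenFiveOrdTwo_of_thetaDisplay_descent
    (hΘ : ∀ p q : ℕ, p.Prime → q.Prime → p % 8 = 5 → q % 4 = 3 → thetaGenusPointDatum p q) :
    CongruentSilentEvenFiveOrdTwo :=
  congruentSilentEvenFiveOrdTwo_of_thetaDisplay_of_selmer_le_eight hΘ selmer_le_eight_sMinus

/-- **C-P2-1 = Theorem 1.1 on `𝒮⁻` from the route-B display `K_B` (all pairs) ALONE.** CONDITIONAL; nothing
asserted. [cite: TianYuanZhang2017, Thm. 3.5 and §3] [cite: SilvermanAEC2009, Prop. X.1.4, Prop. X.4.9, Thm. X.4.2]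
[cite: Miller2011LMS, Def. 1.1 (arXiv:1010.2431 p. 3)] -/
theorem congruentSilentEvenFiveBSDTwo_of_thetaDisplay_descent
    (hΘ : ∀ p q : ℕ, p.Prime → q.Prime → p % 8 = 5 → q % 4 = 3 → thetaGenusPointDatum p q) :
    CongruentSilentEvenFiveBSDTwo :=
  congruentSilentEvenFiveBSDTwo_of_thetaDisplay_of_selmer_le_eight hΘ selmer_le_eight_sMinus

/-- **«`𝓛(2pq)` odd» on `𝒮⁻` from the route-B display ALONE** (TYZ's `𝓛` at the top level; no Selmer fact displayed).
CONDITIONAL; nothing asserted. [cite: TianYuanZhang2017, Thm. 3.5 and §3] [cite: SilvermanAEC2009, Prop. X.1.4, Prop. X.4.9] -/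
theorem odd_scriptL_sMinus_of_thetaDisplay_descent
    (hΘ : ∀ p q : ℕ, p.Prime → q.Prime → p % 8 = 5 → q % 4 = 3 → thetaGenusPointDatum p q) :
    ∀ p q : ℕ, p.Prime → q.Prime → p % 8 = 5 → q % 4 = 3 → jacobiSym p q = -1 →
      ∃ L : ℤ, Odd L ∧ IsScriptL (2 * (p * q)) L :=
  odd_scriptL_sMinus_of_thetaDisplay_of_selmer_le_eight hΘ selmer_le_eight_sMinus

end Summit.BirchSwinnertonDyer.Rank1Residual.P2

end
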